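import Mathlib
import HarnessLib
import Literature.MathematicalPhysics.QuantumLattice.HubbardFermiRadiusBandContinuous
import Summits.HubbardSuperconductivity.HubbardSuperconductivity.Theorems.KLProgrammeFermiSurfaceSharpEnvelope
import Summits.HubbardSuperconductivity.HubbardSuperconductivity.Theorems.KLProgrammeH10TwoPointLimitRelativeSectorCount

/-!
# Salmhofer 1998 Lemma 6/(6.11) for the Hubbard band, part 1: the polar TUBE around the Fermi curve — energy shells lie in it, and its
# area is distributed over the polar angle with density `≤ 2(π + δ)δ`

Cell `gate-hubbard-kl`, seat p4 (C5a lead), g8; t7's CONSUMER HOOK for `Salmhofer1998VolumeImprovementProof.TwoShellVolumeBound` (the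
phase-space geometry input of Salmhofer 1998 Lemma 7 (6.9), F-091 residual per model).  For the Hubbard datum the two energy shells
`{𝐤 ∈ 𝓑 : |ε(𝐤) - μ| ≤ ε_j}` of (6.11) are read in POLAR coordinates about `Γ = 0` (the hole-doped Fermi curve `u_μ(θ)(cos θ, sin θ)`,
`bandFermiRadius`, is star-shaped): with `r = √(x² + y²)`, `θ = arg(x + iy)`,

* `kltsv_radius_sub_le` — a momentum of the closed square with `|ε(𝐤) - μ| ≤ η` (`μ ± η` in a level range `[a, b] ⊂ (-4, 0)` carrying
  `BandBounds`) has `|r - u_μ(θ)| ≤ √2·η/Dt_min` (the cell lemma `cell_of_level_of_angle` at zero angular tolerance: the shell is a polar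
  tube of radial half-width `δ = √2 η/Dt_min`);
* `kltsv_volume_tube_inter_le` — for every measurable set of angles `A`,
  `vol{(x,y) : |r - u_μ(θ)| ≤ δ, θ ∈ A} ≤ (π + δ)(2δ) · vol(A ∩ (-π, π))` (Mathlib's `lintegral_comp_polarCoord_symm`: the Jacobian `r` is
  `≤ u_μ + δ < π + δ`, `klfs_bandFermiRadius_lt_pi`, and the radial section is an interval of length `2δ`; Tonelli);
* `kltsv_map_arg_restrict_tube_le` — the same as a domination of measures on the angle line:
  `(vol⌊tube_δ).map arg ≤ (π + δ)(2δ) • vol⌊(-π, π)` — the form in which the product of two shells is compared with the iterated ANGULAR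
  two-loop integral of fs-1's `kltl_exists_angular_bound` (part 2, `…TwoShellVolume.lean`).

Everything is proved; no definitions, no named facts. [cite: Salmhofer1998, Lemma 7 proof (6.11)–(6.12) (p.22 L173 – p.23 L21)]
-/

noncomputable section

open Real Set MeasureTheory
open scoped ENNReal

-- the tree's namespace `Summit.<Summit>.<Problem>.Theorems` repeats the summit name by design (D-0017)
set_option linter.dupNamespace false

namespace Summit.HubbardSuperconductivity.HubbardSuperconductivity.Theorems

open Literature.MathematicalPhysics.QuantumLattice
open Literature.MathematicalPhysics.QuantumLattice.BandSectorCounting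

/-! ### §1 Polar bookkeeping on the plane -/

/-- The polar angle `θ(x, y) = arg(x + iy)` is measurable. [folklore] -/
theorem kltsv_measurable_argR : Measurable fun x : ℝ × ℝ => Complex.arg ((x.1 : ℂ) + (x.2 : ℂ) * Complex.I) :=
  Complex.measurable_arg.comp (by fun_prop)

/-- The polar radius `r(x, y) = √(x² + y²)` is measurable. [folklore] -/
theorem kltsv_measurable_radius : Measurable fun x : ℝ × ℝ => Real.sqrt (x.1 ^ 2 + x.2 ^ 2) :=
  Real.continuous_sqrt.measurable.comp (by fun_prop)

/-- On the target of the polar chart (`0 < r`, `-π < θ < π`) the point `(r cos θ, r sin θ)` has radius `r` and angle `θ`. [folklore] -/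
theorem kltsv_polar_of_target {p : ℝ × ℝ} (hp : p ∈ polarCoord.target) :
    Real.sqrt ((polarCoord.symm p).1 ^ 2 + (polarCoord.symm p).2 ^ 2) = p.1 ∧
      Complex.arg (((polarCoord.symm p).1 : ℂ) + ((polarCoord.symm p).2 : ℂ) * Complex.I) = p.2 := by
  obtain ⟨hr, hθ⟩ := hp
  simp only [mem_Ioi] at hr
  constructor
  · rw [polarCoord_symm_apply]
    dsimp only
    have h : (p.1 * Real.cos p.2) ^ 2 + (p.1 * Real.sin p.2) ^ 2 = p.1 ^ 2 := by
      nlinarith [Real.cos_sq_add_sin_sq p.2]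
    rw [h, Real.sqrt_sq hr.le]
  · rw [polarCoord_symm_apply]
    dsimp only
    have h : ((p.1 * Real.cos p.2 : ℝ) : ℂ) + ((p.1 * Real.sin p.2 : ℝ) : ℂ) * Complex.I =
        (p.1 : ℂ) * (Complex.cos p.2 + Complex.sin p.2 * Complex.I) := by
      push_cast; ring
    rw [h]
    exact Complex.arg_mul_cos_add_sin_mul_I hr ⟨hθ.1, hθ.2.le⟩

/-! ### §2 Energy shells lie in the polar tube -/

section Shell

variable {a b : ℝ} (B : BandBounds a b) {μ : ℝ} (hμ : μ ∈ Icc a b)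
include B hμ

/-- **An energy shell is a polar tube**: a momentum `k` of the closed square with `|ε(k) - μ| ≤ η`, `a ≤ μ - η`, `μ + η ≤ b`, has
`|√(k₀² + k₁²) - u_μ(arg(k₀ + ik₁))| ≤ √2·η/Dt_min`. [cite: Salmhofer1998, Lemma 7 proof (6.11)–(6.12) (p.22 L179–190)] -/
theorem kltsv_radius_sub_le {k : Fin 2 → ℝ} {η : ℝ} (hk : ∀ i, |k i| ≤ π) (hshell : |sqDispersion k - μ| ≤ η)
    (hlo : a ≤ μ - η) (hhi : μ + η ≤ b) :
    |Real.sqrt (k 0 ^ 2 + k 1 ^ 2) - bandFermiRadius μ (Complex.arg ((k 0 : ℂ) + (k 1 : ℂ) * Complex.I))| ≤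
      Real.sqrt 2 * η / B.Dtmin := by
  have hD := B.Dtmin_pos
  have hη : 0 ≤ η := (abs_nonneg _).trans hshell
  set φ : ℝ := Complex.arg ((k 0 : ℂ) + (k 1 : ℂ) * Complex.I) with hφ
  have hφ' : Complex.arg (⟨k 0, k 1⟩ : ℂ) = φ := by rw [hφ, Complex.mk_eq_add_mul_I]
  -- the cell lemma at zero angular tolerance
  have hcell := RelativeSectorCount.cell_of_level_of_angle B hμ (η := η) (α := 0) (θ₀ := φ) (m := 0) hk hshell hlo hhi
    (by rw [hφ']; simp)
  rw [mul_zero, add_zero] at hcell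
  obtain ⟨hx, hy⟩ := hcell
  -- `k = r (cos φ, sin φ)`
  set z : ℂ := (k 0 : ℂ) + (k 1 : ℂ) * Complex.I with hz
  have hz0 : z ≠ 0 := by
    intro h0
    have h00 : k 0 = 0 := by simpa [hz] using congrArg Complex.re h0
    have h01 : k 1 = 0 := by simpa [hz] using congrArg Complex.im h0
    have : sqDispersion k = -4 := by simp [sqDispersion, h00, h01]; norm_num
    rw [this] at hshell
    have h1 := (abs_le.1 hshell).1
    linarith [B.ha]
  set r : ℝ := Real.sqrt (k 0 ^ 2 + k 1 ^ 2) with hr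
  have hrz : ‖z‖ = r := by
    rw [hr, Complex.norm_eq_sqrt_sq_add_sq]
    simp [hz]
  have hr0 : r ≠ 0 := by rw [← hrz]; exact norm_ne_zero_iff.2 hz0
  have hcos : r * Real.cos φ = k 0 := by
    rw [hφ, Complex.cos_arg hz0, hrz, mul_div_cancel₀ _ hr0]
    simp [hz]
  have hsin : r * Real.sin φ = k 1 := by
    rw [hφ, Complex.sin_arg, hrz, mul_div_cancel₀ _ hr0]
    simp [hz]
  set u : ℝ := bandFermiRadius μ φ with hu
  have hX : k 0 - bandX μ φ = (r - u) * Real.cos φ := by rw [bandX, ← hcos]; ring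
  have hY : k 1 - bandY μ φ = (r - u) * Real.sin φ := by rw [bandY, ← hsin]; ring
  have hsq : (r - u) ^ 2 = (k 0 - bandX μ φ) ^ 2 + (k 1 - bandY μ φ) ^ 2 := by
    rw [hX, hY]; nlinarith [Real.cos_sq_add_sin_sq φ]
  have hb0 : 0 ≤ η / B.Dtmin := by positivity
  have hx2 : (k 0 - bandX μ φ) ^ 2 ≤ (η / B.Dtmin) ^ 2 := by
    rw [← sq_abs]; exact pow_le_pow_left₀ (abs_nonneg _) hx 2
  have hy2 : (k 1 - bandY μ φ) ^ 2 ≤ (η / B.Dtmin) ^ 2 := by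
    rw [← sq_abs]; exact pow_le_pow_left₀ (abs_nonneg _) hy 2
  have h2 : (r - u) ^ 2 ≤ (Real.sqrt 2 * η / B.Dtmin) ^ 2 := by
    rw [hsq, show (Real.sqrt 2 * η / B.Dtmin) ^ 2 = 2 * (η / B.Dtmin) ^ 2 by
      rw [show Real.sqrt 2 * η / B.Dtmin = Real.sqrt 2 * (η / B.Dtmin) by ring, mul_pow, Real.sq_sqrt (by norm_num)]]
    linarith
  have h3 : 0 ≤ Real.sqrt 2 * η / B.Dtmin := by positivity
  exact abs_le_of_sq_le_sq' h2 h3 |>.elim (fun h4 h5 => abs_le.2 ⟨h4, h5⟩)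

end Shell

/-! ### §3 The area of the tube over a set of angles -/

section Tube

variable {μ : ℝ} (hμ₁ : -4 < μ) (hμ₂ : μ < 0)
include hμ₁ hμ₂

/-- **The tube's area over a measurable set of angles**: for `0 ≤ δ` and measurable `A ⊆ ℝ`,
`vol{(x,y) : |√(x²+y²) - u_μ(arg(x+iy))| ≤ δ ∧ arg(x+iy) ∈ A} ≤ (π + δ)(2δ) · vol(A ∩ (-π, π))` (polar coordinates: Jacobian
`r ≤ u_μ + δ < π + δ`, radial sections of length `2δ`). [cite: Salmhofer1998, Lemma 7 proof (6.11)–(6.12) (p.22 L179–190)] -/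
theorem kltsv_volume_tube_inter_le {δ : ℝ} (hδ : 0 ≤ δ) {A : Set ℝ} (hA : MeasurableSet A) :
    volume {x : ℝ × ℝ | |Real.sqrt (x.1 ^ 2 + x.2 ^ 2) - bandFermiRadius μ (Complex.arg ((x.1 : ℂ) + (x.2 : ℂ) * Complex.I))| ≤ δ ∧
        Complex.arg ((x.1 : ℂ) + (x.2 : ℂ) * Complex.I) ∈ A} ≤
      ENNReal.ofReal ((π + δ) * (2 * δ)) * volume (A ∩ Ioo (-π) π) := by
  have hπ := Real.pi_pos
  set u : ℝ → ℝ := bandFermiRadius μ with hu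
  have hucont : Continuous u := continuous_bandFermiRadius hμ₁ hμ₂
  set argR : ℝ × ℝ → ℝ := fun x => Complex.arg ((x.1 : ℂ) + (x.2 : ℂ) * Complex.I) with hargR
  have hargm : Measurable argR := kltsv_measurable_argR
  set T : Set (ℝ × ℝ) := {x | |Real.sqrt (x.1 ^ 2 + x.2 ^ 2) - u (argR x)| ≤ δ ∧ argR x ∈ A} with hT
  have hTm : MeasurableSet T := by
    refine MeasurableSet.inter ?_ (hargm hA)
    exact measurableSet_le ((kltsv_measurable_radius.sub (hucont.measurable.comp hargm)).abs) measurable_const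
  -- the comparison set in polar coordinates
  set S' : Set (ℝ × ℝ) := {p | p.2 ∈ A ∩ Ioo (-π) π ∧ u p.2 - δ ≤ p.1 ∧ p.1 ≤ u p.2 + δ} with hS'
  have hS'm : MeasurableSet S' := by
    refine MeasurableSet.inter (measurable_snd (hA.inter measurableSet_Ioo)) (MeasurableSet.inter ?_ ?_)
    · exact measurableSet_le ((hucont.measurable.comp measurable_snd).sub measurable_const) measurable_fst
    · exact measurableSet_le measurable_fst ((hucont.measurable.comp measurable_snd).add measurable_const)
  -- the volume of the comparison set (Tonelli, radial sections are intervals of length `2δ`)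
  have hsec : ∀ θ : ℝ, volume ((fun r : ℝ => (r, θ)) ⁻¹' S') = (A ∩ Ioo (-π) π).indicator (fun _ => ENNReal.ofReal (2 * δ)) θ := by
    intro θ
    by_cases hθ : θ ∈ A ∩ Ioo (-π) π
    · rw [indicator_of_mem hθ]
      have hset : (fun r : ℝ => (r, θ)) ⁻¹' S' = Icc (u θ - δ) (u θ + δ) := by
        ext r
        simp only [hS', mem_preimage, mem_setOf_eq, mem_Icc]
        exact ⟨fun h => ⟨h.2.1, h.2.2⟩, fun h => ⟨hθ, h.1, h.2⟩⟩
      rw [hset, Real.volume_Icc]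
      congr 1; ring
    · rw [indicator_of_notMem hθ]
      have hset : (fun r : ℝ => (r, θ)) ⁻¹' S' = ∅ := by
        ext r
        simp only [hS', mem_preimage, mem_setOf_eq, mem_empty_iff_false, iff_false, not_and]
        exact fun h1 _ _ => (hθ h1).elim
      rw [hset, measure_empty]
  have hvolS' : volume S' = ENNReal.ofReal (2 * δ) * volume (A ∩ Ioo (-π) π) := by
    rw [Measure.volume_eq_prod, Measure.prod_apply_symm hS'm]
    simp_rw [hsec]
    rw [lintegral_indicator_const (hA.inter measurableSet_Ioo)]
  -- change of variables
  have hcv := lintegral_comp_polarCoord_symm (T.indicator 1)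
  rw [lintegral_indicator_one hTm] at hcv
  -- pointwise comparison on the target of the polar chart
  have hpt : ∀ p ∈ polarCoord.target,
      ENNReal.ofReal p.1 • T.indicator (1 : ℝ × ℝ → ℝ≥0∞) (polarCoord.symm p) ≤ S'.indicator (fun _ => ENNReal.ofReal (π + δ)) p := by
    intro p hp
    obtain ⟨hrad, hang⟩ := kltsv_polar_of_target hp
    by_cases hmem : polarCoord.symm p ∈ T
    · have h1 : |p.1 - u p.2| ≤ δ := by
        have h := hmem.1
        rw [hrad] at h
        have harg : argR (polarCoord.symm p) = p.2 := hang
        rwa [harg] at h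
      have h2 : p.2 ∈ A := by
        have h := hmem.2
        have harg : argR (polarCoord.symm p) = p.2 := hang
        rwa [harg] at h
      have hpS : p ∈ S' := ⟨⟨h2, hp.2⟩, by linarith [(abs_le.1 h1).1], by linarith [(abs_le.1 h1).2]⟩
      rw [indicator_of_mem hmem, indicator_of_mem hpS, Pi.one_apply, smul_eq_mul, mul_one]
      refine ENNReal.ofReal_le_ofReal ?_
      have hu_lt : u p.2 < π := klfs_bandFermiRadius_lt_pi hμ₁ hμ₂ p.2
      linarith [(abs_le.1 h1).2]
    · rw [indicator_of_notMem hmem, smul_zero]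
      exact bot_le
  calc volume T = ∫⁻ p in polarCoord.target, ENNReal.ofReal p.1 • T.indicator (1 : ℝ × ℝ → ℝ≥0∞) (polarCoord.symm p) := hcv.symm
    _ ≤ ∫⁻ p in polarCoord.target, S'.indicator (fun _ => ENNReal.ofReal (π + δ)) p :=
        setLIntegral_mono' polarCoord.open_target.measurableSet hpt
    _ ≤ ∫⁻ p, S'.indicator (fun _ => ENNReal.ofReal (π + δ)) p := setLIntegral_le_lintegral _ _
    _ = ENNReal.ofReal (π + δ) * volume S' := lintegral_indicator_const hS'm _
    _ = ENNReal.ofReal ((π + δ) * (2 * δ)) * volume (A ∩ Ioo (-π) π) := by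
        rw [hvolS', ← mul_assoc, ← ENNReal.ofReal_mul (by positivity)]

/-- **Domination of the angular push-forward of the tube**: `(vol⌊tube_δ).map arg ≤ (π + δ)(2δ) • vol⌊(-π, π)` (`0 ≤ δ`).
[cite: Salmhofer1998, Lemma 7 proof (6.11)–(6.12) (p.22 L179–190)] -/
theorem kltsv_map_arg_restrict_tube_le {δ : ℝ} (hδ : 0 ≤ δ) :
    Measure.map (fun x : ℝ × ℝ => Complex.arg ((x.1 : ℂ) + (x.2 : ℂ) * Complex.I))
        (volume.restrict {x : ℝ × ℝ |
          |Real.sqrt (x.1 ^ 2 + x.2 ^ 2) - bandFermiRadius μ (Complex.arg ((x.1 : ℂ) + (x.2 : ℂ) * Complex.I))| ≤ δ}) ≤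
      ENNReal.ofReal ((π + δ) * (2 * δ)) • volume.restrict (Ioo (-π) π) := by
  rw [Measure.le_iff]
  intro s hs
  rw [Measure.map_apply kltsv_measurable_argR hs, Measure.restrict_apply (kltsv_measurable_argR hs), Measure.smul_apply,
    Measure.restrict_apply hs, smul_eq_mul]
  have h := kltsv_volume_tube_inter_le hμ₁ hμ₂ hδ hs
  have hset : (fun x : ℝ × ℝ => Complex.arg ((x.1 : ℂ) + (x.2 : ℂ) * Complex.I)) ⁻¹' s ∩
      {x : ℝ × ℝ | |Real.sqrt (x.1 ^ 2 + x.2 ^ 2) - bandFermiRadius μ (Complex.arg ((x.1 : ℂ) + (x.2 : ℂ) * Complex.I))| ≤ δ} =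
      {x : ℝ × ℝ | |Real.sqrt (x.1 ^ 2 + x.2 ^ 2) - bandFermiRadius μ (Complex.arg ((x.1 : ℂ) + (x.2 : ℂ) * Complex.I))| ≤ δ ∧
        Complex.arg ((x.1 : ℂ) + (x.2 : ℂ) * Complex.I) ∈ s} := by
    ext x; simp [and_comm]
  rw [hset]
  exact h

/-- **The total area of the tube**: `vol(tube_δ) ≤ (π + δ)(2δ)(2π)`. [cite: Salmhofer1998, Lemma 7 proof (6.11)–(6.12) (p.22 L179–190)] -/
theorem kltsv_volume_tube_le {δ : ℝ} (hδ : 0 ≤ δ) :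
    volume {x : ℝ × ℝ | |Real.sqrt (x.1 ^ 2 + x.2 ^ 2) - bandFermiRadius μ (Complex.arg ((x.1 : ℂ) + (x.2 : ℂ) * Complex.I))| ≤ δ} ≤
      ENNReal.ofReal ((π + δ) * (2 * δ) * (2 * π)) := by
  have h := kltsv_volume_tube_inter_le hμ₁ hμ₂ hδ MeasurableSet.univ
  simp only [mem_univ, and_true, univ_inter] at h
  refine h.trans (le_of_eq ?_)
  rw [Real.volume_Ioo, ← ENNReal.ofReal_mul (by positivity)]
  congr 1; ring

end Tube

end Summit.HubbardSuperconductivity.HubbardSuperconductivity.Theorems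

end
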